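import Mathlib
import Summits.MatrixMultiplication.MatrixMultiplication.Theorems.GradedDesignFamily.Negative.CuspFormRange
import Summits.MatrixMultiplication.MatrixMultiplication.Theorems.GradedDesignFamily.Negative.RelativeCount
import Summits.MatrixMultiplication.MatrixMultiplication.Theorems.LevelGradedCohnUmansGradedDesignFamilyFrameSpan

/-!
# The cusp-form wall for the quadratic-extension cell
# (crux `LevelGradedCohnUmans.GradedDesignFamily`, stmt-MatrixMultiplication-7610; negative side,
# line `quadratic-extension-level-one-cell`, stub S3 `stub_subfieldCell`)

HONEST FRAMING.  This DECIDES nothing about the summit; it is the engine deciding the finite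
cells `q = 4, 5` of S3 by theorem: a VERDICT / CERTIFICATE, not summit progress.

`cuspFormWall`: in S3's configuration — `φ : SL₂(k) →* GL₂(K)` injective, `|K| = |k|²`,
`Y, Z ⊆ GL₂(K)` non-empty, separated from `φ(SL₂ k)` by level-one frame functions (S3's clause
verbatim) — every non-zero `e : SL₂(k) → ℂ` cuspidal for all conjugate root groups
(`Σ_x e(g · b u_x b⁻¹) = 0`) forces
`|Y| + |Z| ≤ (|K| + 1)(|k| − 1) + 1`.

Proof.  `(|Y| + |Z| − 1)·r ≤ dim span T_e(F₁)` (`relativeCount_le`, `r = rank R_e ≥ 1`);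
`T_e F_c = Σ_u η_u T₂(c_u)` with `η_u d = (g ↦ d(g u))`, `η_0 T₂ = 0` (`Σ e = 0`) and
`η_{λu} T₂ d = η_u T₂ (d ∘ λ)`, so `span T_e(F₁)` lies in the image of `(K² lines) × range T₂`,
of dimension `≤ (|K| + 1) · dim range T₂ ≤ (|K| + 1)(|k| − 1)·r` (`cuspForm_finrank_range_le`).

Sorry-free; axioms `propext`, `Classical.choice`, `Quot.sound`.
-/

set_option linter.dupNamespace false

open scoped BigOperators
open Matrix Module

namespace Summit.MatrixMultiplication.MatrixMultiplication.Theorems.GradedDesignFamily.Negative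

/-- **The cusp-form wall.**  In S3's subfield-cell configuration, a non-zero function on
`SL₂(k)` cuspidal for all conjugate root groups gives `|Y| + |Z| ≤ (|K| + 1)(|k| − 1) + 1`.
[folklore] -/
theorem cuspFormWall {k K : Type} [Field k] [Fintype k] [DecidableEq k] [Field K]
    [Fintype K] [DecidableEq K]
    (φ : Matrix.SpecialLinearGroup (Fin 2) k →* Matrix.GeneralLinearGroup (Fin 2) K)
    (hφ : Function.Injective φ) (hK : Fintype.card K = Fintype.card k ^ 2)
    (Y Z : Finset (Matrix.GeneralLinearGroup (Fin 2) K)) (hY : Y.Nonempty) (hZ : Z.Nonempty)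
    (hsep : ∀ z₀ ∈ Z, ∃ cf : (Fin 2 → K) → (Fin 2 → K) → ℂ,
      ∀ a : Matrix.SpecialLinearGroup (Fin 2) k, ∀ y ∈ Y, ∀ y' ∈ Y, ∀ z ∈ Z,
        (∑ u : Fin 2 → K, cf u (((φ a * y * y'⁻¹ * z : Matrix.GeneralLinearGroup (Fin 2) K) :
            Matrix (Fin 2) (Fin 2) K).mulVec u)) =
          if a = 1 ∧ y = y' ∧ z = z₀ then 1 else 0)
    (e : Matrix.SpecialLinearGroup (Fin 2) k → ℂ) (he : ∃ a, e a ≠ 0)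
    (hcusp : ∀ g b : Matrix.SpecialLinearGroup (Fin 2) k,
      ∑ x : k, e (g * b * ⟨!![(1 : k), x; 0, 1], sl2md_det_upper x⟩ * b⁻¹) = 0) :
    Y.card + Z.card ≤ (Fintype.card K + 1) * (Fintype.card k - 1) + 1 := by
  classical
  -- the host space `F₁(K)` (frame span), right-invariant, and S3's separators in packing form
  set FS := Submodule.span ℂ {f : Matrix.GeneralLinearGroup (Fin 2) K → ℂ |
      ∃ c : (Fin 2 → K) → (Fin 2 → K) → ℂ, f = fun g : Matrix.GeneralLinearGroup (Fin 2) K =>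
        ∑ u : Fin 2 → K, c u ((g : Matrix (Fin 2) (Fin 2) K).mulVec u)} with hFS
  have hr : ∀ f ∈ FS, ∀ h : Matrix.GeneralLinearGroup (Fin 2) K, (fun g => f (g * h)) ∈ FS :=
    fun f hf h => by simpa only [one_mul] using SubfieldCell.frameSpan_biInv K f hf 1 h
  have hsepX := SubfieldCell.frameSeparated_image φ hφ Y Z hsep
  have hsep' : ∀ x₀ ∈ Finset.univ.image φ, ∀ z₀ ∈ Z, ∃ f ∈ FS,
      ∀ x ∈ Finset.univ.image φ, ∀ y ∈ Y, ∀ y' ∈ Y, ∀ z ∈ Z,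
        (x = x₀ ∧ y = y' ∧ z = z₀ → f (x⁻¹ * y * y'⁻¹ * z) = 1) ∧
        (¬ (x = x₀ ∧ y = y' ∧ z = z₀) → f (x⁻¹ * y * y'⁻¹ * z) = 0) := by
    intro x₀ hx₀ z₀ hz₀
    obtain ⟨cf, hcf⟩ := hsepX x₀ hx₀ z₀ hz₀
    refine ⟨fun g => ∑ u : Fin 2 → K, cf u ((g : Matrix (Fin 2) (Fin 2) K).mulVec u),
      Submodule.subset_span ⟨cf, rfl⟩, fun x hx y hy y' hy' z hz => ⟨fun h => ?_, fun h => ?_⟩⟩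
    · exact (hcf x hx y hy y' hy' z hz).trans (if_pos h)
    · exact (hcf x hx y hy y' hy' z hz).trans (if_neg h)
  -- the relative count
  have N := relativeCount_le φ hφ FS hr Y Z hY hZ hsep' e
  -- the operators
  set R : (Matrix.SpecialLinearGroup (Fin 2) k → ℂ) →ₗ[ℂ] (Matrix.SpecialLinearGroup (Fin 2) k → ℂ) :=
    ∑ t : Matrix.SpecialLinearGroup (Fin 2) k,
      e t • LinearMap.funLeft ℂ ℂ fun h : Matrix.SpecialLinearGroup (Fin 2) k => t * h with hR_def
  have hR : ∀ (u : Matrix.SpecialLinearGroup (Fin 2) k → ℂ) (h : Matrix.SpecialLinearGroup (Fin 2) k),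
      R u h = ∑ t, e t * u (t * h) := by
    intro u h
    simp only [hR_def, LinearMap.coe_sum, Finset.sum_apply, LinearMap.smul_apply,
      LinearMap.funLeft_apply, Pi.smul_apply, smul_eq_mul]
  set T₂ : ((Fin 2 → K) → ℂ) →ₗ[ℂ] ((Fin 2 → K) → ℂ) :=
    ∑ t : Matrix.SpecialLinearGroup (Fin 2) k,
      e t • LinearMap.funLeft ℂ ℂ fun w : Fin 2 → K =>
        ((φ t : Matrix.GeneralLinearGroup (Fin 2) K) : Matrix (Fin 2) (Fin 2) K) *ᵥ w with hT₂_def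
  have hT₂ : ∀ (d : (Fin 2 → K) → ℂ) (w : Fin 2 → K),
      T₂ d w = ∑ t, e t * d ((φ t).val *ᵥ w) := by
    intro d w
    simp only [hT₂_def, LinearMap.coe_sum, Finset.sum_apply, LinearMap.smul_apply,
      LinearMap.funLeft_apply, Pi.smul_apply, smul_eq_mul]
  have hsum := cuspForm_sum_eq_zero e hcusp
  have hW := cuspForm_finrank_range_le φ hφ hK e hcusp
  -- `r ≥ 1`: `R δ₁ = (h ↦ e h⁻¹) ≠ 0`
  obtain ⟨a, ha⟩ := he
  have hr_pos : 0 < finrank ℂ (LinearMap.range R) := by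
    have hne : R (Pi.single 1 1) ≠ 0 := by
      intro h0
      have h1 : R (Pi.single 1 1) a⁻¹ = e a := by
        rw [hR]
        simp only [Pi.single_apply, mul_inv_eq_one]
        simp
      rw [h0, Pi.zero_apply] at h1
      exact ha h1.symm
    have h1 : finrank ℂ (ℂ ∙ R (Pi.single 1 1)) = 1 := finrank_span_singleton hne
    have h2 : (ℂ ∙ R (Pi.single 1 1)) ≤ LinearMap.range R :=
      (Submodule.span_singleton_le_iff_mem _ _).2 (LinearMap.mem_range_self R _)
    have h3 := Submodule.finrank_mono h2
    omega
  -- line representatives of `K²`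
  let LR : Finset (Fin 2 → K) := insert ![0, 1] (Finset.univ.image fun x : K => ![1, x])
  have hLR_card : LR.card ≤ Fintype.card K + 1 := by
    refine (Finset.card_insert_le _ _).trans ?_
    simpa using Finset.card_image_le (s := (Finset.univ : Finset K)) (f := fun x : K => ![1, x])
  have hLR_cover : ∀ u : Fin 2 → K, u ≠ 0 → ∃ ℓ ∈ LR, ∃ c : K, u = c • ℓ := by
    intro u hu
    by_cases h0 : u 0 = 0
    · refine ⟨![0, 1], Finset.mem_insert_self _ _, u 1, ?_⟩
      funext i
      fin_cases i
      · simp [h0]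
      · simp
    · refine ⟨![1, u 1 / u 0], Finset.mem_insert_of_mem (Finset.mem_image.2 ⟨u 1 / u 0,
        Finset.mem_univ _, rfl⟩), u 0, ?_⟩
      funext i
      fin_cases i
      · simp
      · simp [mul_div_cancel₀ _ h0]
  -- `Ψ₁ c = Σ_{ℓ ∈ LR} η_ℓ (c ℓ)`
  let Ψ₁ : (↥LR → ↥(LinearMap.range T₂)) →ₗ[ℂ] (Matrix.GeneralLinearGroup (Fin 2) K → ℂ) :=
    { toFun := fun c g => ∑ ℓ : ↥LR, (c ℓ : (Fin 2 → K) → ℂ)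
        ((g : Matrix (Fin 2) (Fin 2) K) *ᵥ (ℓ : Fin 2 → K))
      map_add' := fun c c' => by
        funext g
        simp only [Pi.add_apply, Submodule.coe_add, Finset.sum_add_distrib]
      map_smul' := fun r c => by
        funext g
        simp only [Pi.smul_apply, Submodule.coe_smul, smul_eq_mul, RingHom.id_apply,
          Finset.mul_sum] }
  have hΨ₁ : ∀ (c : ↥LR → ↥(LinearMap.range T₂)) (g : Matrix.GeneralLinearGroup (Fin 2) K),
      Ψ₁ c g = ∑ ℓ : ↥LR, (c ℓ : (Fin 2 → K) → ℂ)
        ((g : Matrix (Fin 2) (Fin 2) K) *ᵥ (ℓ : Fin 2 → K)) := fun c g => rfl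
  -- `span T_e(F₁) ≤ range Ψ₁`
  have hle : Submodule.span ℂ ((fun f : Matrix.GeneralLinearGroup (Fin 2) K → ℂ =>
      fun g : Matrix.GeneralLinearGroup (Fin 2) K => ∑ t : Matrix.SpecialLinearGroup (Fin 2) k,
        e t * f (φ t * g)) '' (FS : Set (Matrix.GeneralLinearGroup (Fin 2) K → ℂ))) ≤
      LinearMap.range Ψ₁ := by
    rw [Submodule.span_le]
    rintro _ ⟨f, hf, rfl⟩
    obtain ⟨c, hc⟩ := SubfieldCell.exists_coeff_of_mem_frameSpan K hf
    have hTf : (fun g : Matrix.GeneralLinearGroup (Fin 2) K =>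
        ∑ t : Matrix.SpecialLinearGroup (Fin 2) k, e t * f (φ t * g)) =
        ∑ u : Fin 2 → K, fun g : Matrix.GeneralLinearGroup (Fin 2) K =>
          ∑ t : Matrix.SpecialLinearGroup (Fin 2) k,
            e t * c u ((φ t).val *ᵥ ((g : Matrix (Fin 2) (Fin 2) K) *ᵥ u)) := by
      funext g
      simp only [Finset.sum_apply, hc, Finset.mul_sum]
      rw [Finset.sum_comm]
      refine Finset.sum_congr rfl fun u _ => Finset.sum_congr rfl fun t _ => ?_
      rw [Units.val_mul, ← Matrix.mulVec_mulVec]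
    change (fun g : Matrix.GeneralLinearGroup (Fin 2) K =>
        ∑ t : Matrix.SpecialLinearGroup (Fin 2) k, e t * f (φ t * g)) ∈ LinearMap.range Ψ₁
    rw [hTf]
    refine Submodule.sum_mem _ fun u _ => ?_
    by_cases hu : u = 0
    · subst hu
      have h0 : (fun g : Matrix.GeneralLinearGroup (Fin 2) K =>
          ∑ t : Matrix.SpecialLinearGroup (Fin 2) k,
            e t * c 0 ((φ t).val *ᵥ ((g : Matrix (Fin 2) (Fin 2) K) *ᵥ 0))) = 0 := by
        funext g
        simp only [Matrix.mulVec_zero, Pi.zero_apply]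
        rw [← Finset.sum_mul, hsum, zero_mul]
      rw [h0]
      exact zero_mem _
    · obtain ⟨ℓ, hℓ, cl, hul⟩ := hLR_cover u hu
      refine LinearMap.mem_range.2
        ⟨Pi.single ⟨ℓ, hℓ⟩ ⟨T₂ (fun w => c u (cl • w)), LinearMap.mem_range_self T₂ _⟩, ?_⟩
      funext g
      rw [hΨ₁, Fintype.sum_eq_single ⟨ℓ, hℓ⟩ fun ℓ' hℓ' => by
        rw [Pi.single_eq_of_ne hℓ']
        simp]
      rw [Pi.single_eq_same]
      change T₂ (fun w => c u (cl • w)) ((g : Matrix (Fin 2) (Fin 2) K) *ᵥ ℓ) = _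
      rw [hT₂]
      refine Finset.sum_congr rfl fun t _ => ?_
      rw [hul, Matrix.mulVec_smul, Matrix.mulVec_smul]
  -- dimensions
  have hdom : finrank ℂ (↥LR → ↥(LinearMap.range T₂)) =
      LR.card * finrank ℂ (LinearMap.range T₂) := by
    rw [Module.finrank_pi_fintype ℂ, Finset.sum_const, Finset.card_univ, Fintype.card_coe,
      smul_eq_mul]
  have hspan : finrank ℂ (Submodule.span ℂ ((fun f : Matrix.GeneralLinearGroup (Fin 2) K → ℂ =>
      fun g : Matrix.GeneralLinearGroup (Fin 2) K => ∑ t : Matrix.SpecialLinearGroup (Fin 2) k,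
        e t * f (φ t * g)) '' (FS : Set (Matrix.GeneralLinearGroup (Fin 2) K → ℂ)))) ≤
      (Fintype.card K + 1) * ((Fintype.card k - 1) * finrank ℂ (LinearMap.range R)) :=
    calc _ ≤ finrank ℂ (LinearMap.range Ψ₁) := Submodule.finrank_mono hle
      _ ≤ finrank ℂ (↥LR → ↥(LinearMap.range T₂)) := LinearMap.finrank_range_le Ψ₁
      _ = LR.card * finrank ℂ (LinearMap.range T₂) := hdom
      _ ≤ (Fintype.card K + 1) * ((Fintype.card k - 1) * finrank ℂ (LinearMap.range R)) :=
          Nat.mul_le_mul hLR_card hW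
  -- assemble
  have key : (Y.card + Z.card - 1) * finrank ℂ (LinearMap.range R) ≤
      ((Fintype.card K + 1) * (Fintype.card k - 1)) * finrank ℂ (LinearMap.range R) := by
    rw [mul_assoc]
    exact N.trans hspan
  have := Nat.le_of_mul_le_mul_right key hr_pos
  omega

end Summit.MatrixMultiplication.MatrixMultiplication.Theorems.GradedDesignFamily.Negative
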